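import Literature.NumberTheory.EllipticCurves.PAdicMeasureTransformBranches
import Literature.NumberTheory.EllipticCurves.PAdicLFunctionInterpolationHoldsProofs
import HarnessLib

/-!
# The `ω^i`-branches `L_p(f, α, ω^i, T)` of the Mazur–Tate–Teitelbaum `p`-adic `L`-function
# INTERPOLATE at the wild characters (proofs only)

Topic `NumberTheory/EllipticCurves`; namespace `Literature.NumberTheory.EllipticCurves`. THEOREMS ONLY
(no definition, no named fact; D-0014, D-0026).

`PAdicLFunctionBranch` defines the `ω^i`-branch `padicLFunctionBranch f α i = ∫_{ℤ_p^×} ω^i(x)(1+T)^{ℓ(x)} dμ_{f,α}`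
of the Mazur–Swinnerton-Dyer measure as the power series of the limits of the `η^i`-weighted Riemann
sums (Mazur–Tate–Teitelbaum, Invent. Math. 84 (1986) §I.13, "`L_p(f, α, χ, T)`" for a tame
character `χ = ω^i`); `PAdicLFunctionBranchConstantTermProofs` evaluated it at `T = 0` only, and
`PAdicMeasureTransformBranches` proved that its coefficients are those of the TRIVIAL branch of the
twisted bounded distribution `ω^i μ_{f,α}` (`branchTwist`, `weightedRiemannSum_eq`). This file draws
the consequence the tree was missing — the INTERPOLATION PROPERTY of the branch at every wild
character (MTT §I.13: "`L_p(P, χψ) = ∫ χψ dμ`"; §I.14 (14.3)): for a character `κ` of `Γ` of level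
`p^{m+1} ≥ p^{e₀}` (even, of `p`-power order),

  `L_p(f, α, ω^i, κ(γ) − 1) = ∑_{a mod p^{m+1}} κ(a) ω(a)^i μ_{f,α}(a + p^{m+1}ℤ_p)`
  (`hasSum_padicLBranchCoeff_mul_pow_of_distribution` — the abstract Mellin transform
  `hasSum_limUnder_riemannSum_mul_pow_of_distribution` of `PAdicMeasureTransform` applied to `ω^i μ_{f,α}`),

and, when `κ` is PRIMITIVE of conductor `p^{m+1}` with `m ≥ e₀` (so that `ω^i` is defined modulo
`p^m` and the character `κ ω^i` still has conductor `p^{m+1}`), the lower-level term of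
`μ_{f,α}(a + p^{m+1}ℤ_p) = α^{−(m+1)}[a/p^{m+1}]⁺ − α^{−(m+2)}[a/p^m]⁺` drops out
(`sum_mul_msdMeasure_mul_teichWeight_succ`: `[a/p^m]⁺ ω(a)^i` is constant on the fibres over
`ℤ/p^m` and the coset sums of `κ` vanish, `sum_fiber_eq_zero_of_not_factorsThrough`), whence

  `L_p(f, α, ω^i, κ(γ) − 1) = α^{−(m+1)} ∑_{a mod p^{m+1}} κ(a) ω(a)^i [a/p^{m+1}]⁺_f`
  (`hasSum_padicLBranchCoeff_mul_pow_of_isPrimitive`; MTT §I.14 (14.3) at the character `χ = κω^i` of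
  conductor `p^{m+1}`: `e_α(χ)·∑ χ(a)[a/p^{m+1}]⁺ = α^{−(m+1)} τ(χ) L(f, χ̄, 1)/Ω⁺_f` by Birch's formula),

with the unconditional specialisation to the newform of an elliptic curve at a good ordinary prime
and its unit root (`…_of_isNewformOf`: distribution relation and boundedness are the tree's
`msdMeasure_distribution_of_isNewformOf`, `exists_norm_msdMeasure_le_of_isNewformOf`), and the
boundedness of the branch (`norm_coeff_padicLFunctionBranch_le_of_isNewformOf`). For `i = 0` these are
the statements of `PAdicLFunctionInterpolationProofs` (`hasSum_padicLCoeff_mul_pow`); the weight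
`ω(a)^i = teichWeight p i (a mod p^{e₀})` is the tree's (`PAdicLFunctionBranchConstantTermProofs`).

Motivation (cell `b2b-bsdres`, sub-cell additive-p2, X3♯(G-ord)/X4♯(G-ord) defect 2): the
dictionary between the E-normalised tame branch of an additive curve `E = E♭ ⊗ χ_{p*}` (Delbourgo 1998
§1.5) and the branch `L_p(f_{E♭}, α, ω^{(p−1)/2}, T)` of its good ordinary twist, at the level of
POWER SERIES (not only at `T = 0`).

What is NOT here: the odd (minus-symbol) branches (`padicLFunctionMinusBranch`; same proof with
`msdMinusMeasure`), `p`-adic `L`-functions of forms with nebentypus, Birch's formula in `ℂ`.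

References: B. Mazur, J. Tate, J. Teitelbaum, *On `p`-adic analogues of the conjectures of Birch and
Swinnerton-Dyer*, Invent. Math. 84 (1986) 1–48, §I.10 (10.1), §I.11, §I.13, §I.14 (14.3)
[MazurTateTeitelbaum1986Invent]; B. Mazur, P. Swinnerton-Dyer, Invent. Math. 25 (1974) §8–§9
[MazurSwinnertonDyer1974Invent]; L. C. Washington, GTM 83, §7.2, §12.2 [Washington1997].
-/

noncomputable section

open Filter Topology

open scoped MatrixGroups ModularForm

namespace Literature.NumberTheory.EllipticCurves

open CongruenceSubgroup Literature.NumberTheory.EllipticCurves.ModularForms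

variable {p : ℕ} [Fact p.Prime] {N : ℕ} (f : CuspForm (Gamma0 N) 2) (α : ℚ_[p])

/-! ### Interpolation of the `ω^i`-branch at every character of `Γ` -/

section AnyCharacter

/-- **The `ω^i`-branch interpolates `ω^i μ_{f,α}` at every character of `Γ`** (Mazur–Tate–Teitelbaum
1986 §I.13, `L_p(P, χ) = ∫ χ dμ_P` applied to `P = ω^i μ_{f,α}`): if `μ_{f,α}` satisfies the
distribution relation and is bounded, then for every `m` with `p^{m+1} ≥ p^{e₀}` and every Dirichlet
character `κ` mod `p^{m+1}` with values in `ℂ_p` which is a character of `Γ` (even, of `p`-power order),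
`∑_k [T^k]L_p(f, α, ω^i, T)·(κ(γ) − 1)^k = ∑_{a mod p^{m+1}} κ(a)·μ_{f,α}(a + p^{m+1}ℤ_p)·ω(a)^i`
in `ℂ_p` (`ω(a)^i = teichWeight p i (a mod p^{e₀})`, `γ = cyclotomicGenerator p`). The abstract
transform `hasSum_limUnder_riemannSum_mul_pow_of_distribution` applied to the twisted bounded
distribution `branchTwist i μ_{f,α}`, whose Riemann sums are the weighted ones
(`weightedRiemannSum_eq`) and whose level-`p^{m+1}` values are `μ·ω^i` (`branchTwist_apply_of_distribution`).
[cite: MazurTateTeitelbaum1986Invent, §I.13–I.14 (14.3)] -/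
theorem hasSum_padicLBranchCoeff_mul_pow_of_distribution
    (hdist : ∀ (n : ℕ) (a : ZMod (p ^ n)),
      ∑ b ∈ Finset.univ.filter (fun b : ZMod (p ^ (n + 1)) ↦
        ZMod.castHom (pow_dvd_pow p n.le_succ) (ZMod (p ^ n)) b = a), msdMeasure f α (n + 1) b =
        msdMeasure f α n a)
    {C : ℝ} (hC : ∀ (n : ℕ) (a : ZMod (p ^ n)), ‖msdMeasure f α n a‖ ≤ C) (i : ℕ) {m : ℕ}
    (hm : cyclotomicExponent p ≤ m + 1) (κ : DirichletCharacter ℂ_[p] (p ^ (m + 1))) (heven : κ.Even)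
    (hord : ∃ j : ℕ, orderOf κ = p ^ j) :
    HasSum (fun k : ℕ ↦ algebraMap ℚ_[p] ℂ_[p] (padicLBranchCoeff f α i k) *
        (κ (cyclotomicGenerator p : ZMod (p ^ (m + 1))) - 1) ^ k)
      (∑ a : ZMod (p ^ (m + 1)), κ a * algebraMap ℚ_[p] ℂ_[p] (msdMeasure f α (m + 1) a *
        teichWeight p i (ZMod.castHom (pow_dvd_pow p hm) (ZMod (p ^ cyclotomicExponent p)) a))) := by
  have h := hasSum_limUnder_riemannSum_mul_pow_of_distribution (μ := branchTwist i (msdMeasure f α))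
    (RS := padicLBranchRiemannSum f α i)
    (fun k n ↦ weightedRiemannSum_eq (RS := padicLBranchRiemannSum f α i) (fun _ _ ↦ rfl) hdist k n)
    (branchTwist_distribution hdist i) (norm_branchTwist_le hC i) κ heven hord
  simp_rw [branchTwist_apply_of_distribution hdist i hm] at h
  exact h

end AnyCharacter

/-! ### Primitive characters of conductor `p^{m+1}`, `m ≥ e₀`: the lower-level term drops out -/

section Primitive

/-- **Evaluation of `ω^i μ_{f,α}` at level `p^{m+1}` against a PRIMITIVE character, `m ≥ e₀`**:
`∑_{a mod p^{m+1}} κ(a)·μ_{f,α}(a + p^{m+1}ℤ_p)·ω(a)^i = α^{−(m+1)} ∑_a κ(a)·ω(a)^i·[a/p^{m+1}]⁺_f`.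
The second term `α^{−(m+2)} ∑_a κ(a) ω(a)^i [a/p^m]⁺` of the measure (MTT §I.10 (10.1)) vanishes:
`[a/p^m]⁺` (`ratPlusSymbol_div_pow_eq_of_castHom`) and `ω(a)^i` (which factors through `a mod p^{e₀}`,
`e₀ ≤ m`) only depend on `a mod p^m`, and the coset sums of the primitive `κ` over the fibres of
`ℤ/p^{m+1} → ℤ/p^m` vanish (`sum_fiber_eq_zero_of_not_factorsThrough`). The `i = 0` case is the
tree's `sum_mul_msdMeasure_succ` (Mazur–Tate–Teitelbaum 1986 §I.14, proof of (14.3)).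
[cite: MazurTateTeitelbaum1986Invent, §I.10 (10.1) and §I.14 (14.3)] -/
theorem sum_mul_msdMeasure_mul_teichWeight_succ [NeZero N] (htr : ratPlusSymbol_add_intCast f)
    (i : ℕ) {m : ℕ} (hm : cyclotomicExponent p ≤ m) (κ : DirichletCharacter ℂ_[p] (p ^ (m + 1)))
    (hκ : κ.IsPrimitive) :
    ∑ a : ZMod (p ^ (m + 1)), κ a * algebraMap ℚ_[p] ℂ_[p] (msdMeasure f α (m + 1) a *
        teichWeight p i (ZMod.castHom (pow_dvd_pow p (hm.trans m.le_succ))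
          (ZMod (p ^ cyclotomicExponent p)) a)) =
      algebraMap ℚ_[p] ℂ_[p] (α⁻¹ ^ (m + 1)) *
        ∑ a : ZMod (p ^ (m + 1)), κ a *
          algebraMap ℚ_[p] ℂ_[p] (teichWeight p i (ZMod.castHom (pow_dvd_pow p (hm.trans m.le_succ))
            (ZMod (p ^ cyclotomicExponent p)) a)) *
          (ratPlusSymbol f ((a.val : ℚ) / ((p ^ (m + 1) : ℕ) : ℚ)) : ℂ_[p]) := by
  classical
  haveI : NeZero (p ^ (m + 1)) := ⟨pow_ne_zero _ (Fact.out : p.Prime).ne_zero⟩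
  haveI : NeZero (p ^ m) := ⟨pow_ne_zero _ (Fact.out : p.Prime).ne_zero⟩
  set w : ZMod (p ^ (m + 1)) → ℚ_[p] := fun a ↦ teichWeight p i
    (ZMod.castHom (pow_dvd_pow p (hm.trans m.le_succ)) (ZMod (p ^ cyclotomicExponent p)) a) with hw
  -- the weight factors through `ℤ/p^m`
  have hwfac : ∀ a : ZMod (p ^ (m + 1)), w a = teichWeight p i
      (ZMod.castHom (pow_dvd_pow p hm) (ZMod (p ^ cyclotomicExponent p))
        (ZMod.castHom (pow_dvd_pow p m.le_succ) (ZMod (p ^ m)) a)) := by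
    intro a
    rw [hw]
    dsimp only
    rw [castHom_castHom_zmod]
  -- the second term vanishes
  have hvan : ∑ a : ZMod (p ^ (m + 1)),
      κ a * algebraMap ℚ_[p] ℂ_[p] (w a) * (ratPlusSymbol f ((a.val : ℚ) / (p : ℚ) ^ m) : ℂ_[p]) = 0 := by
    rw [← Finset.sum_fiberwise Finset.univ
      (ZMod.castHom (pow_dvd_pow p m.le_succ) (ZMod (p ^ m)))]
    refine Finset.sum_eq_zero fun a₀ _ ↦ ?_
    have hconst : ∀ a ∈ Finset.univ.filter (fun a : ZMod (p ^ (m + 1)) ↦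
        ZMod.castHom (pow_dvd_pow p m.le_succ) (ZMod (p ^ m)) a = a₀),
        κ a * algebraMap ℚ_[p] ℂ_[p] (w a) * (ratPlusSymbol f ((a.val : ℚ) / (p : ℚ) ^ m) : ℂ_[p]) =
          κ a * (algebraMap ℚ_[p] ℂ_[p] (teichWeight p i
            (ZMod.castHom (pow_dvd_pow p hm) (ZMod (p ^ cyclotomicExponent p)) a₀)) *
            (ratPlusSymbol f ((a₀.val : ℚ) / (p : ℚ) ^ m) : ℂ_[p])) := by
      intro a ha
      rw [ratPlusSymbol_div_pow_eq_of_castHom htr m.le_succ a, hwfac a, (Finset.mem_filter.mp ha).2,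
        mul_assoc]
    rw [Finset.sum_congr rfl hconst, ← Finset.sum_mul,
      sum_fiber_eq_zero_of_not_factorsThrough κ _ (not_factorsThrough_of_isPrimitive hκ
        (Nat.pow_lt_pow_right (Nat.Prime.one_lt Fact.out) m.lt_succ_self)) a₀, zero_mul]
  -- the first term
  have hmain : ∀ a : ZMod (p ^ (m + 1)),
      κ a * algebraMap ℚ_[p] ℂ_[p] (msdMeasure f α (m + 1) a * w a) =
        algebraMap ℚ_[p] ℂ_[p] (α⁻¹ ^ (m + 1)) *
            (κ a * algebraMap ℚ_[p] ℂ_[p] (w a) *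
              (ratPlusSymbol f ((a.val : ℚ) / ((p ^ (m + 1) : ℕ) : ℚ)) : ℂ_[p])) -
          algebraMap ℚ_[p] ℂ_[p] (α⁻¹ ^ (m + 2)) *
            (κ a * algebraMap ℚ_[p] ℂ_[p] (w a) *
              (ratPlusSymbol f ((a.val : ℚ) / (p : ℚ) ^ m) : ℂ_[p])) := by
    intro a
    simp only [msdMeasure, map_sub, map_mul, map_ratCast, Nat.cast_pow, sub_mul]
    ring
  rw [Finset.sum_congr rfl fun a _ ↦ hmain a, Finset.sum_sub_distrib, ← Finset.mul_sum,
    ← Finset.mul_sum, hvan, mul_zero, sub_zero]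

/-- **Interpolation of the `ω^i`-branch at the PRIMITIVE wild characters** (Mazur–Tate–Teitelbaum
1986 §I.14 (14.3) at the character `κω^i` of conductor `p^{m+1}`): if `μ_{f,α}` is a bounded
distribution with `[r + 1]⁺ = [r]⁺`, then for every `m ≥ e₀` and every primitive Dirichlet character
`κ` of conductor `p^{m+1}` with values in `ℂ_p` which is a character of `Γ`,
`L_p(f, α, ω^i, κ(γ) − 1) = α^{−(m+1)} ∑_{a mod p^{m+1}} κ(a) ω(a)^i [a/p^{m+1}]⁺_f`.
[cite: MazurTateTeitelbaum1986Invent, §I.13–I.14 (14.3)] -/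
theorem hasSum_padicLBranchCoeff_mul_pow_of_isPrimitive [NeZero N]
    (hdist : ∀ (n : ℕ) (a : ZMod (p ^ n)),
      ∑ b ∈ Finset.univ.filter (fun b : ZMod (p ^ (n + 1)) ↦
        ZMod.castHom (pow_dvd_pow p n.le_succ) (ZMod (p ^ n)) b = a), msdMeasure f α (n + 1) b =
        msdMeasure f α n a)
    {C : ℝ} (hC : ∀ (n : ℕ) (a : ZMod (p ^ n)), ‖msdMeasure f α n a‖ ≤ C)
    (htr : ratPlusSymbol_add_intCast f) (i : ℕ) {m : ℕ} (hm : cyclotomicExponent p ≤ m)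
    (κ : DirichletCharacter ℂ_[p] (p ^ (m + 1))) (hκ : κ.IsPrimitive) (heven : κ.Even)
    (hord : ∃ j : ℕ, orderOf κ = p ^ j) :
    HasSum (fun k : ℕ ↦ algebraMap ℚ_[p] ℂ_[p] (padicLBranchCoeff f α i k) *
        (κ (cyclotomicGenerator p : ZMod (p ^ (m + 1))) - 1) ^ k)
      (algebraMap ℚ_[p] ℂ_[p] (α⁻¹ ^ (m + 1)) *
        ∑ a : ZMod (p ^ (m + 1)), κ a *
          algebraMap ℚ_[p] ℂ_[p] (teichWeight p i (ZMod.castHom (pow_dvd_pow p (hm.trans m.le_succ))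
            (ZMod (p ^ cyclotomicExponent p)) a)) *
          (ratPlusSymbol f ((a.val : ℚ) / ((p ^ (m + 1) : ℕ) : ℚ)) : ℂ_[p])) := by
  rw [← sum_mul_msdMeasure_mul_teichWeight_succ f α htr i hm κ hκ]
  exact hasSum_padicLBranchCoeff_mul_pow_of_distribution f α hdist hC i (hm.trans m.le_succ) κ heven
    hord

end Primitive

/-! ### The newform of an elliptic curve at a good ordinary prime and its unit root -/

section Elliptic

variable {N : ℕ} [NeZero N] {f : CuspForm (Gamma0 N) 2} {p : ℕ} [Fact p.Prime]
  {W : WeierstrassCurve ℚ} [W.IsGloballyMinimal] [W.IsElliptic]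

/-- **The `ω^i`-branches of `L_p(E, T)` are bounded**: for the newform `f` of `E = W` at a good
ordinary prime `p` and `α = unitRoot W p`, `‖[T^k]L_p(f, α, ω^i, T)‖ ≤ C` for one `C` and all `k`
(Mazur–Tate–Teitelbaum 1986 §I.12: the branches lie in `Λ ⊗ ℚ_p`), by `norm_padicLBranchCoeff_le`
and the unconditional boundedness of `μ_{f,α}`. [cite: MazurTateTeitelbaum1986Invent, §I.12–I.13] -/
theorem exists_norm_coeff_padicLFunctionBranch_le_of_isNewformOf (hord : IsOrdinaryAt W p)
    (hf : IsNewformOf W f) (i : ℕ) :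
    ∃ C : ℝ, ∀ k : ℕ,
      ‖PowerSeries.coeff k (padicLFunctionBranch f (unitRoot W p : ℚ_[p]) i)‖ ≤ C := by
  obtain ⟨C, hC⟩ := exists_norm_msdMeasure_le_of_isNewformOf (f := f) hord hf
  exact ⟨C, fun k ↦ by
    rw [coeff_padicLFunctionBranch]
    exact norm_padicLBranchCoeff_le f _ (msdMeasure_distribution_of_isNewformOf hord hf) hC i k⟩

/-- **Interpolation of the `ω^i`-branch of `L_p(E, T)`, unconditionally** (Mazur–Tate–Teitelbaum
1986 §I.14 (14.3); Mazur–Swinnerton-Dyer 1974 §9): for the newform `f` of `E = W` at a good ordinary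
prime `p`, `α = unitRoot W p`, every `m ≥ e₀` and every primitive Dirichlet character `κ` of conductor
`p^{m+1}` with values in `ℂ_p` which is a character of `Γ`,
`∑_k [T^k]L_p(f, α, ω^i, T)·(κ(γ) − 1)^k = α^{−(m+1)} ∑_{a mod p^{m+1}} κ(a) ω(a)^i [a/p^{m+1}]⁺_f`;
the inputs (distribution relation, boundedness, `1`-periodicity of `[·]⁺`) are the tree's theorems.
[cite: MazurTateTeitelbaum1986Invent, §I.14 (14.3)] -/
theorem hasSum_coeff_padicLFunctionBranch_mul_pow_of_isNewformOf (hord : IsOrdinaryAt W p)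
    (hf : IsNewformOf W f) (i : ℕ) {m : ℕ} (hm : cyclotomicExponent p ≤ m)
    (κ : DirichletCharacter ℂ_[p] (p ^ (m + 1))) (hκ : κ.IsPrimitive) (heven : κ.Even)
    (hord' : ∃ j : ℕ, orderOf κ = p ^ j) :
    HasSum (fun k : ℕ ↦ algebraMap ℚ_[p] ℂ_[p]
          (PowerSeries.coeff k (padicLFunctionBranch f (unitRoot W p : ℚ_[p]) i)) *
        (κ (cyclotomicGenerator p : ZMod (p ^ (m + 1))) - 1) ^ k)
      (algebraMap ℚ_[p] ℂ_[p] ((unitRoot W p : ℚ_[p])⁻¹ ^ (m + 1)) *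
        ∑ a : ZMod (p ^ (m + 1)), κ a *
          algebraMap ℚ_[p] ℂ_[p] (teichWeight p i (ZMod.castHom (pow_dvd_pow p (hm.trans m.le_succ))
            (ZMod (p ^ cyclotomicExponent p)) a)) *
          (ratPlusSymbol f ((a.val : ℚ) / ((p ^ (m + 1) : ℕ) : ℚ)) : ℂ_[p])) := by
  obtain ⟨C, hC⟩ := exists_norm_msdMeasure_le_of_isNewformOf (f := f) hord hf
  simp only [coeff_padicLFunctionBranch]
  exact hasSum_padicLBranchCoeff_mul_pow_of_isPrimitive f _
    (msdMeasure_distribution_of_isNewformOf hord hf) hC ratPlusSymbol_add_intCast_holds i hm κ hκ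
    heven hord'

end Elliptic

end Literature.NumberTheory.EllipticCurves

end
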